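import Mathlib
import HarnessLib
import Literature.MathematicalPhysics.QuantumLattice.FermiRG.BGM2003Sectors
import Summits.HubbardSuperconductivity.HubbardSuperconductivity.Theorems.KLProgrammeAbsUmklappClassCount34
import Summits.HubbardSuperconductivity.HubbardSuperconductivity.Theorems.KLProgrammeAbsUmklappCoverage34

/-!
# Route `KLProgramme` — K3 engine (stmt-HubbardSuperconductivity-20437), stub (b) (ℓ)/(I2)–(I3), located item «ABS-UMK-COUNT» / «ABS-UMK-34-SIGNPAT»:
# the NARROW-BUNDLE COUNT with a prescribed nonempty set of legs and ≥ 3 FREE LEGS — `≤ (M_g·2·L³)·(T_def + T_indef)·K₁^{L − |E| − 3}`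

Cell gate-hubbard-kl, seat p4 g16 (≥ 3-free-leg twin of `card_narrowStrings_prescribed_le`, p623334).  Narrow strings (agreeing with `τ` on `E ∋ s`, free legs
pairwise within pair angle `Φ₀`, momenta summing to `R`) are covered (`exists_class34_of_free`) by the sign-pattern classes of `card_class34_same_le` /
`card_class34_opp_le`, indexed by a grid shift `m < M_g = ⌊2π/Φ₀⌋ + 1`, a side `σ′ ∈ {0,1}` and an ordered triple of free legs:

* **`card_narrowStrings34_le`** — `#narrow ≤ (M_g·2·L³)·(T_def + T_indef)·K₁^{L − (|E|+3)}`, the `(L − |E| − 2)` law (times one logarithm inside `T_indef`)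
  for narrow bundles with at least three free legs.

Everything is PROVED; no definitions, no named facts. [cite: BenfattoGiulianiMastropietro2003, §7.4 (s1.21)–(s1.25a) p.28 (L19–52)]
-/

noncomputable section

open Real Set
open Literature.MathematicalPhysics.QuantumLattice Literature.MathematicalPhysics.QuantumLattice.FermiRG
open Literature.MathematicalPhysics.QuantumLattice.FermiRG.BGM2003
open Summit.HubbardSuperconductivity.HubbardSuperconductivity.Theorems.ThinLevelSet
open Summit.HubbardSuperconductivity.HubbardSuperconductivity.Theorems

namespace Summit.HubbardSuperconductivity.HubbardSuperconductivity.Theorems.AbsUmklappCount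

set_option linter.dupNamespace false -- summit = problem name (single-conjunct summit), D-0017

open Classical in
set_option maxHeartbeats 800000 in -- two large class predicates instantiated per index; membership bookkeeping
/-- **The narrow-bundle count with a prescribed nonempty set of legs and at least three free legs.**  See the module docstring.
[cite: BenfattoGiulianiMastropietro2003, §7.4 (s1.21)–(s1.25a) p.28 (L19–52)] -/
theorem card_narrowStrings34_le {ε : (Fin 2 → ℝ) → ℝ} {μ e₀ : ℝ} {u : ℝ → ℝ → ℝ} (hD : DispersionHyp ε μ e₀ u) {c₃ : ℝ} (hc₃ : 0 < c₃)
    (h73 : ∀ (n ω : ℕ), ω < sectorCount n → ∀ p ∈ sSector u e₀ n ω,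
      ∃ k₁ k₂ : ℝ,
        p = fermiPoint u (sectorCenter n ω) + k₁ • unitNormal u (sectorCenter n ω) 0 +
              k₂ • unitTangent u (sectorCenter n ω) 0 ∧
        |k₁| ≤ c₃ * (4 : ℝ) ^ (-(n : ℤ)) ∧ |k₂| ≤ c₃ * (2 : ℝ) ^ (-(n : ℤ)) ∧
        |fderiv ℝ ε p (unitTangent u (sectorCenter n ω) 0)| ≤ c₃ * (2 : ℝ) ^ (-(n : ℤ)))
    {s₁ Φ cf Af Bf M₁ : ℝ} (hs₁ : 0 < s₁) (hM₁ : 0 ≤ M₁) (hΦ : 0 < Φ) (hcf : 0 < cf) (hcfA : cf ≤ Af) (hBf : 0 ≤ Bf)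
    (hchart : ∀ θs : ℝ, ∃ f f' f'' : ℝ → ℝ, Measurable f ∧
        (∀ φ ∈ Icc (-Φ) Φ,
          f ((fermiPoint u (θs + φ) - fermiPoint u θs) ⬝ᵥ tdir θs) = -((fermiPoint u (θs + φ) - fermiPoint u θs) ⬝ᵥ dir θs)) ∧
        (∀ y ∈ Icc (-(s₁ / 4 * Φ)) (s₁ / 4 * Φ), HasDerivAt f (f' y) y ∧ HasDerivAt f' (f'' y) y ∧
          cf ≤ f'' y ∧ f'' y ≤ Af ∧ |f' y| ≤ Bf) ∧
        (∀ φ ∈ Icc (-Φ) Φ, ∀ φ' ∈ Icc (-Φ) Φ,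
          s₁ / 2 * |φ - φ'| ≤ |(fermiPoint u (θs + φ) - fermiPoint u θs) ⬝ᵥ tdir θs - (fermiPoint u (θs + φ') - fermiPoint u θs) ⬝ᵥ tdir θs| ∧
          |(fermiPoint u (θs + φ) - fermiPoint u θs) ⬝ᵥ tdir θs - (fermiPoint u (θs + φ') - fermiPoint u θs) ⬝ᵥ tdir θs| ≤ M₁ * |φ - φ'|) ∧
        (fermiPoint u (θs + 0) - fermiPoint u θs) ⬝ᵥ tdir θs = 0)
    {n' L : ℕ} (E : Finset (Fin L)) (hE : E.card + 3 ≤ L) {s : Fin L} (hsE : s ∈ E) (τ : Fin L → Fin (sectorCount n')) (R : Fin 2 → ℝ)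
    {Φ₀ : ℝ} (hΦ₀ : 0 < Φ₀) (h2Φ₀ : 2 * Φ₀ ≤ Φ)
    (hreg : 6 * (M₁ * (2 * Φ₀)) + 3 * (L * (4 * c₃ * (2 : ℝ) ^ (-(n' : ℤ)))) + 2 * (s₁ / 2 * sectorWidth n') ≤ s₁ / 4 * Φ) :
    ((((Finset.univ : Finset (Fin L → Fin (sectorCount n'))).filter fun ω =>
        ((∀ e ∈ E, ω e = τ e) ∧ (∀ i j : Fin L, i ∉ E → j ∉ E → pairAngle (sectorCenter n' (ω i)) (sectorCenter n' (ω j)) ≤ Φ₀)) ∧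
        ∃ k : Fin L → (Fin 2 → ℝ), (∀ i, k i ∈ sSector u e₀ n' (ω i : ℕ)) ∧ ∑ i, k i = R).card : ℝ)) ≤
      (((⌊2 * π / Φ₀⌋₊ + 1 : ℕ) : ℝ) * 2 * (L : ℝ) ^ 3) *
      ((2 * (L * (4 * c₃ * (2 : ℝ) ^ (-(n' : ℤ)))) / (s₁ / 2 * sectorWidth n') + 1) *
          (960 * Af * (2 * (L * (4 * c₃ * (2 : ℝ) ^ (-(n' : ℤ))) + Bf * (L * (4 * c₃ * (2 : ℝ) ^ (-(n' : ℤ))))) +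
            (4 * Bf + 1) * (s₁ / 2 * sectorWidth n')) / cf ^ 2 / (s₁ / 2 * sectorWidth n') ^ 2) +
        (2 * (L * (4 * c₃ * (2 : ℝ) ^ (-(n' : ℤ)))) / (s₁ / 2 * sectorWidth n') + 1) *
          (4 * (2 * (M₁ * (2 * Φ₀)) / (s₁ / 2 * sectorWidth n') + 1) +
            4 * (L * (4 * c₃ * (2 : ℝ) ^ (-(n' : ℤ))) + Bf * (L * (4 * c₃ * (2 : ℝ) ^ (-(n' : ℤ))))) / (cf * (s₁ / 2 * sectorWidth n') ^ 2) *
              (1 + Real.log ((4 * (M₁ * (2 * Φ₀)) + L * (4 * c₃ * (2 : ℝ) ^ (-(n' : ℤ)))) / (s₁ / 2 * sectorWidth n') + 1)))) *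
      (2 * (2 * (2 * Φ₀) / sectorWidth n' + 1)) ^ (L - (E.card + 3)) := by
  have hw := sectorWidth_pos n'
  have hAf : 0 < Af := hcf.trans_le hcfA
  set Tdef : ℝ := (2 * (L * (4 * c₃ * (2 : ℝ) ^ (-(n' : ℤ)))) / (s₁ / 2 * sectorWidth n') + 1) *
          (960 * Af * (2 * (L * (4 * c₃ * (2 : ℝ) ^ (-(n' : ℤ))) + Bf * (L * (4 * c₃ * (2 : ℝ) ^ (-(n' : ℤ))))) +
            (4 * Bf + 1) * (s₁ / 2 * sectorWidth n')) / cf ^ 2 / (s₁ / 2 * sectorWidth n') ^ 2) with hTdef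
  set Tind : ℝ := (2 * (L * (4 * c₃ * (2 : ℝ) ^ (-(n' : ℤ)))) / (s₁ / 2 * sectorWidth n') + 1) *
          (4 * (2 * (M₁ * (2 * Φ₀)) / (s₁ / 2 * sectorWidth n') + 1) +
            4 * (L * (4 * c₃ * (2 : ℝ) ^ (-(n' : ℤ))) + Bf * (L * (4 * c₃ * (2 : ℝ) ^ (-(n' : ℤ))))) / (cf * (s₁ / 2 * sectorWidth n') ^ 2) *
              (1 + Real.log ((4 * (M₁ * (2 * Φ₀)) + L * (4 * c₃ * (2 : ℝ) ^ (-(n' : ℤ)))) / (s₁ / 2 * sectorWidth n') + 1))) with hTind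
  have hTdef0 : 0 ≤ Tdef := by rw [hTdef]; positivity
  have hlog : 0 ≤ Real.log ((4 * (M₁ * (2 * Φ₀)) + L * (4 * c₃ * (2 : ℝ) ^ (-(n' : ℤ)))) / (s₁ / 2 * sectorWidth n') + 1) :=
    Real.log_nonneg (by
      have : 0 ≤ (4 * (M₁ * (2 * Φ₀)) + L * (4 * c₃ * (2 : ℝ) ^ (-(n' : ℤ)))) / (s₁ / 2 * sectorWidth n') := by positivity
      linarith)
  have hTind0 : 0 ≤ Tind := by rw [hTind]; positivity
  set K : ℝ := (2 * (2 * (2 * Φ₀) / sectorWidth n' + 1)) ^ (L - (E.card + 3)) with hK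
  have hK0 : 0 ≤ K := by rw [hK]; positivity
  set Mg : ℕ := ⌊2 * π / Φ₀⌋₊ + 1 with hMg
  -- the narrow set
  set Nar := (Finset.univ : Finset (Fin L → Fin (sectorCount n'))).filter fun ω =>
        ((∀ e ∈ E, ω e = τ e) ∧ (∀ i j : Fin L, i ∉ E → j ∉ E → pairAngle (sectorCenter n' (ω i)) (sectorCenter n' (ω j)) ≤ Φ₀)) ∧
        ∃ k : Fin L → (Fin 2 → ℝ), (∀ i, k i ∈ sSector u e₀ n' (ω i : ℕ)) ∧ ∑ i, k i = R with hNar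
  -- the two classes of an index `((m, σ′), ((a, b), c))`
  set ClS : (ℕ × ℕ) × ((Fin L × Fin L) × Fin L) → Finset (Fin L → Fin (sectorCount n')) := fun idx =>
    (Finset.univ : Finset (Fin L → Fin (sectorCount n'))).filter fun ω =>
        ((∀ e ∈ E, ω e = τ e) ∧ (∀ i : Fin L, i ∉ E →
          pairAngle (sectorCenter n' (ω i)) (sectorCenter n' (τ s) + ((idx.1.1 : ℝ) * Φ₀ + (idx.1.2 : ℝ) * π)) ≤ 2 * Φ₀)) ∧
        (∀ x ∈ ({idx.2.1.1, idx.2.1.2, idx.2.2} : Finset (Fin L)),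
          FermiRG.torusDist (sectorCenter n' (ω x) - (sectorCenter n' (ω s) + ((idx.1.1 : ℝ) * Φ₀ + (idx.1.2 : ℝ) * π))) ≤ 2 * Φ₀) ∧
        ∃ k : Fin L → (Fin 2 → ℝ), (∀ i, k i ∈ sSector u e₀ n' (ω i : ℕ)) ∧ ∑ i, k i = R with hClS
  set ClO : (ℕ × ℕ) × ((Fin L × Fin L) × Fin L) → Finset (Fin L → Fin (sectorCount n')) := fun idx =>
    (Finset.univ : Finset (Fin L → Fin (sectorCount n'))).filter fun ω =>
        ((∀ e ∈ E, ω e = τ e) ∧ (∀ i : Fin L, i ∉ E →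
          pairAngle (sectorCenter n' (ω i)) (sectorCenter n' (τ s) + ((idx.1.1 : ℝ) * Φ₀ + (idx.1.2 : ℝ) * π)) ≤ 2 * Φ₀)) ∧
        (FermiRG.torusDist (sectorCenter n' (ω idx.2.1.1) - (sectorCenter n' (ω s) + ((idx.1.1 : ℝ) * Φ₀ + (idx.1.2 : ℝ) * π))) ≤ 2 * Φ₀ ∧
          FermiRG.torusDist (sectorCenter n' (ω idx.2.1.2) - (sectorCenter n' (ω s) + ((idx.1.1 : ℝ) * Φ₀ + (idx.1.2 : ℝ) * π))) ≤ 2 * Φ₀ ∧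
          FermiRG.torusDist (sectorCenter n' (ω idx.2.2) - (sectorCenter n' (ω s) + ((idx.1.1 : ℝ) * Φ₀ + (idx.1.2 : ℝ) * π) + π)) ≤ 2 * Φ₀) ∧
        ∃ k : Fin L → (Fin 2 → ℝ), (∀ i, k i ∈ sSector u e₀ n' (ω i : ℕ)) ∧ ∑ i, k i = R with hClO
  -- admissible triples and the index set
  set Adm : Finset ((Fin L × Fin L) × Fin L) := (Finset.univ : Finset ((Fin L × Fin L) × Fin L)).filter fun t =>
    t.1.1 ∉ E ∧ t.1.2 ∉ E ∧ t.2 ∉ E ∧ t.1.1 ≠ t.1.2 ∧ t.1.1 ≠ t.2 ∧ t.1.2 ≠ t.2 with hAdm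
  set I : Finset ((ℕ × ℕ) × ((Fin L × Fin L) × Fin L)) := (Finset.range Mg ×ˢ Finset.range 2) ×ˢ Adm with hI
  -- per-index bound
  have hcl : ∀ idx ∈ I, (((ClS idx ∪ ClO idx).card : ℕ) : ℝ) ≤ (Tdef + Tind) * K := by
    rintro ⟨⟨m, σ'⟩, ⟨⟨a, b⟩, c⟩⟩ hidx
    rw [hI, Finset.mem_product, Finset.mem_product, hAdm, Finset.mem_filter] at hidx
    obtain ⟨-, -, haE, hbE, hcE, hab, hac, hbc⟩ := hidx
    simp only at haE hbE hcE hab hac hbc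
    have hS := card_class34_same_le hD hc₃ h73 hs₁ hM₁ hΦ hcf hcfA hBf hchart E τ s a b c hsE haE hbE hcE hab hac hbc R hΦ₀.le h2Φ₀
      ((m : ℝ) * Φ₀ + (σ' : ℝ) * π) hreg
    have hO := card_class34_opp_le hD hc₃ h73 hs₁ hM₁ hΦ hcf hBf hchart E τ s a b c hsE haE hbE hcE hab hac hbc R hΦ₀.le h2Φ₀
      ((m : ℝ) * Φ₀ + (σ' : ℝ) * π) hreg
    have hS' : (((ClS ((m, σ'), ((a, b), c))).card : ℕ) : ℝ) ≤ Tdef * K := by rw [hClS, hTdef, hK]; exact hS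
    have hO' : (((ClO ((m, σ'), ((a, b), c))).card : ℕ) : ℝ) ≤ Tind * K := by rw [hClO, hTind, hK]; exact hO
    calc (((ClS ((m, σ'), ((a, b), c)) ∪ ClO ((m, σ'), ((a, b), c))).card : ℕ) : ℝ)
        ≤ (((ClS ((m, σ'), ((a, b), c))).card : ℕ) : ℝ) + (((ClO ((m, σ'), ((a, b), c))).card : ℕ) : ℝ) := by
          exact_mod_cast Finset.card_union_le _ _
      _ ≤ Tdef * K + Tind * K := add_le_add hS' hO'
      _ = (Tdef + Tind) * K := by ring
  -- coverage
  have hcover : Nar ⊆ I.biUnion fun idx => ClS idx ∪ ClO idx := by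
    intro ω hω
    rw [hNar, Finset.mem_filter] at hω
    obtain ⟨-, ⟨hωE, hnar⟩, hk⟩ := hω
    have hFcard : 3 ≤ (Eᶜ : Finset (Fin L)).card := by rw [Finset.card_compl, Fintype.card_fin]; omega
    obtain ⟨m, hm, σ', hσ', a, b, c, ha, hb, hc, hab, hac, hbc, hpair, hca, hcb, hcc⟩ :=
      exists_class34_of_free (Eᶜ : Finset (Fin L)) hFcard (fun i => sectorCenter n' (ω i)) (sectorCenter n' (τ s)) hΦ₀
        (fun i j hi hj => hnar i j (Finset.mem_compl.1 hi) (Finset.mem_compl.1 hj))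
    have haE := Finset.mem_compl.1 ha
    have hbE := Finset.mem_compl.1 hb
    have hcE := Finset.mem_compl.1 hc
    have hωs : sectorCenter n' (ω s) = sectorCenter n' (τ s) := by rw [hωE s hsE]
    rw [Finset.mem_biUnion]
    refine ⟨((m, σ'), ((a, b), c)), ?_, ?_⟩
    · rw [hI, Finset.mem_product, Finset.mem_product, Finset.mem_range, Finset.mem_range, hAdm, Finset.mem_filter]
      exact ⟨⟨hm, hσ'⟩, Finset.mem_univ _, haE, hbE, hcE, hab, hac, hbc⟩
    rw [Finset.mem_union]
    rcases hcc with hcc | hcc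
    · left
      rw [hClS, Finset.mem_filter]
      refine ⟨Finset.mem_univ _, ⟨hωE, fun i hi => hpair i (Finset.mem_compl.2 hi)⟩, ?_, hk⟩
      intro x hx
      simp only [Finset.mem_insert, Finset.mem_singleton] at hx
      rw [hωs]
      rcases hx with rfl | rfl | rfl
      · exact hca
      · exact hcb
      · exact hcc
    · right
      rw [hClO, Finset.mem_filter]
      refine ⟨Finset.mem_univ _, ⟨hωE, fun i hi => hpair i (Finset.mem_compl.2 hi)⟩, ?_, hk⟩
      simp only
      rw [hωs]
      exact ⟨hca, hcb, hcc⟩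
  -- the index count
  have hIcard : ((I.card : ℕ) : ℝ) ≤ ((Mg : ℕ) : ℝ) * 2 * (L : ℝ) ^ 3 := by
    have h1 : I.card ≤ Mg * 2 * L ^ 3 := by
      rw [hI, Finset.card_product, Finset.card_product, Finset.card_range, Finset.card_range]
      have h2 : Adm.card ≤ L ^ 3 := by
        calc Adm.card ≤ (Finset.univ : Finset ((Fin L × Fin L) × Fin L)).card := Finset.card_le_card (Finset.filter_subset _ _)
          _ = L ^ 3 := by rw [Finset.card_univ, Fintype.card_prod, Fintype.card_prod, Fintype.card_fin]; ring
      exact Nat.mul_le_mul_left _ h2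
    exact_mod_cast h1
  -- assemble
  calc ((Nar.card : ℕ) : ℝ) ≤ (((I.biUnion fun idx => ClS idx ∪ ClO idx).card : ℕ) : ℝ) := by
        exact_mod_cast Finset.card_le_card hcover
    _ ≤ ∑ idx ∈ I, (((ClS idx ∪ ClO idx).card : ℕ) : ℝ) := by exact_mod_cast Finset.card_biUnion_le
    _ ≤ ∑ _idx ∈ I, (Tdef + Tind) * K := Finset.sum_le_sum hcl
    _ = (I.card : ℝ) * ((Tdef + Tind) * K) := by rw [Finset.sum_const, nsmul_eq_mul]
    _ ≤ (((Mg : ℕ) : ℝ) * 2 * (L : ℝ) ^ 3) * ((Tdef + Tind) * K) := mul_le_mul_of_nonneg_right hIcard (by positivity)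
    _ = (((Mg : ℕ) : ℝ) * 2 * (L : ℝ) ^ 3) * (Tdef + Tind) * K := by ring

end Summit.HubbardSuperconductivity.HubbardSuperconductivity.Theorems.AbsUmklappCount

end
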